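import Summits.Langlands.Langlands.Theses.RationalPeriodQuarter
import Literature.NumberTheory.Automorphic.BLZPeriodCocycleProofs
import Literature.NumberTheory.Automorphic.InvariantLaplacian
import Literature.NumberTheory.Automorphic.PiecewiseRational
import Literature.NumberTheory.Automorphic.PrincipalSeriesLineModel

/-!
# Birth skeleton — piece `HeckePeriodIntertwining` of the decomposition of `HeckePreservesRationalPeriods`
(route RationalPeriodQuarter, parent crux stmt-Langlands-2807; strategist planner-cstrat-stmt-Langlands-2807-r1-0)

Two registered stubs, the two textbook properties of the period integral `∫_a^b [u, R(t;·)^s]`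
(Bruggeman–Lewis–Zagier §1–2): LINEARITY in `u` over `C²` functions (`stub_linear`: the integrand is
linear in `u` and each summand is integrable along the compact segment) and the PULL-BACK LAW under
`g ∈ GL₂⁺(ℝ)` (`stub_pullback`: `∫_a^b [u∘g, R_t^s] = (det g)^s · (∫_{ga}^{gb} [u, R^s])|_{2s} g (t)` off the
pole of `g` — BLZ (2.25) `R(·; gz)^s|g = (det g)^{-s} R(·; z)^s` + (1.10a) `[u∘g, v∘g] = [u,v]∘g` +
closedness (1.10c); in the tree for `g ∈ Γ` of determinant one as `lineSlash_greenPeriod`), and the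
kernel-checked composition `HeckePeriodIntertwining_of`: `T'_p u = Σ_j p^{-1/2} · u ∘ M_j` as functions on
`ℍ`, the `p + 1` pull-backs, and the cancellation `p^{-1/2} (det M_j)^{1/2} = 1` (the normalisation the
crux was worried about). Sorries ONLY inside `stub_*`.
-/

noncomputable section

set_option linter.dupNamespace false

namespace Summit.Langlands.Langlands.Cruxes.HeckePreservesRationalPeriods.BirthHeckePeriodIntertwining

open scoped MatrixGroups Topology
open Filter Set
open Literature.NumberTheory.Automorphic UpperHalfPlane

/-- The piece, verbatim (child `HeckePeriodIntertwining`; not yet a route decl). -/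
def HeckePeriodIntertwining : Prop :=
  let IsQuarterCuspForm : ℕ → (UpperHalfPlane → ℂ) → Prop := fun N u => Literature.NumberTheory.Automorphic.IsC2 u ∧ (∀ γ ∈ CongruenceSubgroup.Gamma1 N, ∀ z : UpperHalfPlane, u (γ • z) = u z) ∧ (∀ z : UpperHalfPlane, Literature.NumberTheory.Automorphic.hypLaplacian u z + (1 / 4 : ℂ) * u z = 0) ∧ ∃ C : ℝ, ∀ z : UpperHalfPlane, ‖u z‖ ≤ C; ∀ N : ℕ, 0 < N → ∀ p : ℕ, p.Prime → ¬ p ∣ N → ∀ σ ∈ CongruenceSubgroup.Gamma0 N, (((σ : Matrix (Fin 2) (Fin 2) ℤ) 1 1 : ℤ) : ZMod N) = (p : ZMod N) → let M : Fin (p + 1) → Matrix (Fin 2) (Fin 2) ℤ := (fun j : Fin (p + 1) => if (j : ℕ) < p then !![(1 : ℤ), ((j : ℕ) : ℤ); 0, (p : ℤ)] else (σ : Matrix (Fin 2) (Fin 2) ℤ) * !![(p : ℤ), 0; 0, 1]); let A : Fin (p + 1) → UpperHalfPlane → UpperHalfPlane := (fun (j : Fin (p + 1)) (z : UpperHalfPlane)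 => if (j : ℕ) < p then UpperHalfPlane.ofComplex (((z : ℂ) + ((j : ℕ) : ℂ)) / (p : ℂ)) else σ • UpperHalfPlane.ofComplex ((p : ℂ) * (z : ℂ))); ∀ u : UpperHalfPlane → ℂ, IsQuarterCuspForm N u → ∀ γ : Matrix.SpecialLinearGroup (Fin 2) ℤ, ∀ᶠ t in Filter.cofinite, Literature.NumberTheory.Automorphic.lewisZagierCocycle (1 / 2) UpperHalfPlane.I (fun z : UpperHalfPlane => ((Real.sqrt p : ℝ) : ℂ)⁻¹ * (∑ b ∈ Finset.range p, u (UpperHalfPlane.ofComplex (((z : ℂ) + b) / p)) + u (σ • UpperHalfPlane.ofComplex ((p : ℂ) * (z : ℂ))))) (Matrix.SpecialLinearGroup.mapGL ℝ γ) t = ∑ j : Fin (p + 1), Literature.NumberTheory.Automorphic.slashHalf (M j) (Literature.NumberTheory.Automorphic.greenPeriod (1 / 2) u (A j (γ⁻¹ • UpperHalfPlane.I)) (A j UpperHalfPlane.I)) t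

/-- The route's `IsQuarterCuspForm` (verbatim). -/
def IsQuarterCuspFormR : ℕ → (UpperHalfPlane → ℂ) → Prop := fun N u => Literature.NumberTheory.Automorphic.IsC2 u ∧ (∀ γ ∈ CongruenceSubgroup.Gamma1 N, ∀ z : UpperHalfPlane, u (γ • z) = u z) ∧ (∀ z : UpperHalfPlane, Literature.NumberTheory.Automorphic.hypLaplacian u z + (1 / 4 : ℂ) * u z = 0) ∧ ∃ C : ℝ, ∀ z : UpperHalfPlane, ‖u z‖ ≤ C

/-- The `p + 1` integer Hecke matrices (verbatim). -/
def heckeMat (p : ℕ) (σ : SL(2, ℤ)) : Fin (p + 1) → Matrix (Fin 2) (Fin 2) ℤ := (fun j : Fin (p + 1) => if (j : ℕ) < p then !![(1 : ℤ), ((j : ℕ) : ℤ); 0, (p : ℤ)] else (σ : Matrix (Fin 2) (Fin 2) ℤ) * !![(p : ℤ), 0; 0, 1])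

/-- Their action on `ℍ` (verbatim). -/
def heckeAct (p : ℕ) (σ : SL(2, ℤ)) : Fin (p + 1) → UpperHalfPlane → UpperHalfPlane := (fun (j : Fin (p + 1)) (z : UpperHalfPlane) => if (j : ℕ) < p then UpperHalfPlane.ofComplex (((z : ℂ) + ((j : ℕ) : ℂ)) / (p : ℂ)) else σ • UpperHalfPlane.ofComplex ((p : ℂ) * (z : ℂ)))

/-- The route's `T'_p` (verbatim). -/
def heckeT (p : ℕ) (σ : SL(2, ℤ)) (u : UpperHalfPlane → ℂ) : UpperHalfPlane → ℂ := (fun z : UpperHalfPlane => ((Real.sqrt p : ℝ) : ℂ)⁻¹ * (∑ b ∈ Finset.range p, u (UpperHalfPlane.ofComplex (((z : ℂ) + b) / p)) + u (σ • UpperHalfPlane.ofComplex ((p : ℂ) * (z : ℂ)))))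

theorem heckePeriodIntertwining_iff : HeckePeriodIntertwining ↔
    ∀ N : ℕ, 0 < N → ∀ p : ℕ, p.Prime → ¬ p ∣ N → ∀ σ ∈ CongruenceSubgroup.Gamma0 N,
      (((σ : Matrix (Fin 2) (Fin 2) ℤ) 1 1 : ℤ) : ZMod N) = (p : ZMod N) →
      ∀ u : UpperHalfPlane → ℂ, IsQuarterCuspFormR N u → ∀ γ : SL(2, ℤ), ∀ᶠ t in cofinite,
        lewisZagierCocycle (1 / 2) UpperHalfPlane.I (heckeT p σ u) (Matrix.SpecialLinearGroup.mapGL ℝ γ) t =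
          ∑ j : Fin (p + 1), Literature.NumberTheory.Automorphic.slashHalf (heckeMat p σ j)
            (greenPeriod (1 / 2) u (heckeAct p σ j (γ⁻¹ • UpperHalfPlane.I)) (heckeAct p σ j UpperHalfPlane.I)) t :=
  Iff.rfl

theorem sl_smul_eq_mapGL_smul (γ : SL(2, ℤ)) (z : ℍ) :
    γ • z = (Matrix.SpecialLinearGroup.mapGL ℝ γ) • z := rfl

/-! ## The Hecke matrices as elements of `GL₂(ℝ)⁺` -/

section HeckeGL

variable (p : ℕ) (σ : SL(2, ℤ))

/-- An integer matrix of non-zero determinant as an element of `GL₂(ℝ)`. -/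
theorem map_intCast_mul (A B : Matrix (Fin 2) (Fin 2) ℤ) :
    (A * B).map (Int.cast : ℤ → ℝ) = A.map (Int.cast : ℤ → ℝ) * B.map (Int.cast : ℤ → ℝ) := by
  ext i j
  simp [Matrix.mul_apply, Fin.sum_univ_two]

theorem det_map_intCast (M : Matrix (Fin 2) (Fin 2) ℤ) :
    (M.map (Int.cast : ℤ → ℝ)).det = ((M.det : ℤ) : ℝ) := by
  rw [show M.map (Int.cast : ℤ → ℝ) = (Int.castRingHom ℝ).mapMatrix M from rfl, ← RingHom.map_det]
  simp

def glOfDet (M : Matrix (Fin 2) (Fin 2) ℤ) (h : M.det ≠ 0) : GL (Fin 2) ℝ :=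
  Matrix.GeneralLinearGroup.mkOfDetNeZero (M.map (Int.cast : ℤ → ℝ)) (by
    rw [det_map_intCast]; exact_mod_cast h)

@[simp] theorem glOfDet_apply (M : Matrix (Fin 2) (Fin 2) ℤ) (h : M.det ≠ 0) (i j : Fin 2) :
    (glOfDet M h) i j = ((M i j : ℤ) : ℝ) := rfl

theorem glOfDet_coe (M : Matrix (Fin 2) (Fin 2) ℤ) (h : M.det ≠ 0) :
    ((glOfDet M h : GL (Fin 2) ℝ) : Matrix (Fin 2) (Fin 2) ℝ) = M.map (Int.cast : ℤ → ℝ) := rfl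

theorem glOfDet_det (M : Matrix (Fin 2) (Fin 2) ℤ) (h : M.det ≠ 0) :
    (glOfDet M h).det.val = ((M.det : ℤ) : ℝ) := by
  rw [Matrix.GeneralLinearGroup.val_det_apply, glOfDet_coe, det_map_intCast]

variable {p} in
theorem heckeMat_det (_hp : p.Prime) (j : Fin (p + 1)) : (heckeMat p σ j).det = p := by
  unfold heckeMat
  split_ifs with hj
  · simp [Matrix.det_fin_two_of]
  · rw [Matrix.det_mul, σ.det_coe, Matrix.det_fin_two_of]; ring

variable {p} in
theorem heckeMat_det_ne_zero (hp : p.Prime) (j : Fin (p + 1)) : (heckeMat p σ j).det ≠ 0 := by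
  rw [heckeMat_det σ hp j]; exact_mod_cast hp.ne_zero

variable {p} in
/-- The Hecke matrices in `GL₂(ℝ)`. -/
def heckeGL (hp : p.Prime) (j : Fin (p + 1)) : GL (Fin 2) ℝ :=
  glOfDet (heckeMat p σ j) (heckeMat_det_ne_zero σ hp j)

variable {p} in
theorem heckeGL_det_pos (hp : p.Prime) (j : Fin (p + 1)) : 0 < (heckeGL σ hp j).det.val := by
  unfold heckeGL; rw [glOfDet_det, heckeMat_det σ hp j]; exact_mod_cast hp.pos

variable {p} in
theorem heckeGL_apply (hp : p.Prime) (j : Fin (p + 1)) (i k : Fin 2) :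
    (heckeGL σ hp j) i k = ((heckeMat p σ j i k : ℤ) : ℝ) := rfl

/-- The route's `slashHalf` by an integer matrix is the line-model slash at `s = 1/2` by the
corresponding element of `GL₂(ℝ)` (same junk value `0` at the pole). -/
theorem slashHalf_eq_lineSlash (M : Matrix (Fin 2) (Fin 2) ℤ) (h : M.det ≠ 0) (φ : ℝ → ℂ) (t : ℝ) :
    Literature.NumberTheory.Automorphic.slashHalf M φ t = lineSlash (1 / 2) (glOfDet M h) φ t := by
  rw [lineSlash_one_half]
  rfl

theorem mapGL_coe_eq_map (γ : SL(2, ℤ)) :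
    ((Matrix.SpecialLinearGroup.mapGL ℝ γ : GL (Fin 2) ℝ) : Matrix (Fin 2) (Fin 2) ℝ) =
      (γ : Matrix (Fin 2) (Fin 2) ℤ).map (Int.cast : ℤ → ℝ) := by
  ext i j
  rw [Matrix.map_apply]
  exact mapGL_real_apply γ i j

variable {p} in
/-- Transport of an integer matrix identity `M_j γ = δ M_k` to `GL₂(ℝ)`. -/
theorem heckeGL_mul_eq (hp : p.Prime) {j k : Fin (p + 1)} {γ δ : SL(2, ℤ)}
    (h : heckeMat p σ j * (γ : Matrix (Fin 2) (Fin 2) ℤ) = (δ : Matrix (Fin 2) (Fin 2) ℤ) * heckeMat p σ k) :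
    heckeGL σ hp j * Matrix.SpecialLinearGroup.mapGL ℝ γ =
      Matrix.SpecialLinearGroup.mapGL ℝ δ * heckeGL σ hp k := by
  apply Units.ext
  simp only [Units.val_mul, heckeGL, glOfDet_coe, mapGL_coe_eq_map, ← map_intCast_mul, h]

variable {p} in
/-- The route's action of the `j`-th Hecke matrix is the Möbius action of `heckeGL j`. -/
theorem heckeAct_eq_smul (hp : p.Prime) (j : Fin (p + 1)) (z : ℍ) :
    heckeAct p σ j z = heckeGL σ hp j • z := by
  have hp0 : (0 : ℝ) < p := by exact_mod_cast hp.pos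
  unfold heckeAct
  by_cases hj : (j : ℕ) < p
  · rw [if_pos hj]
    have him : 0 < ((((z : ℂ) + ((j : ℕ) : ℂ)) / (p : ℂ))).im := by
      rw [Complex.div_natCast_im]
      simp only [Complex.add_im, UpperHalfPlane.coe_im, Complex.natCast_im, add_zero]
      exact div_pos z.im_pos hp0
    apply UpperHalfPlane.ext
    rw [UpperHalfPlane.ofComplex_apply_of_im_pos him, UpperHalfPlane.coe_smul_of_det_pos (heckeGL_det_pos σ hp j)]
    simp only [UpperHalfPlane.num, UpperHalfPlane.denom, heckeGL, glOfDet_coe, heckeMat, if_pos hj,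
      Matrix.map_apply, Matrix.of_apply, Matrix.cons_val', Matrix.cons_val_zero, Matrix.cons_val_one,
      Matrix.empty_val', Matrix.cons_val_fin_one, Int.cast_one, Int.cast_natCast, Int.cast_zero,
      Complex.ofReal_one, Complex.ofReal_natCast, Complex.ofReal_zero, one_mul, zero_mul, zero_add]
  · rw [if_neg hj]
    have him : 0 < ((p : ℂ) * (z : ℂ)).im := by
      simp only [Complex.mul_im, Complex.natCast_re, UpperHalfPlane.coe_im, Complex.natCast_im,
        UpperHalfPlane.coe_re, zero_mul, add_zero]
      exact mul_pos hp0 z.im_pos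
    have hdetD : (!![(p : ℤ), 0; 0, 1] : Matrix (Fin 2) (Fin 2) ℤ).det ≠ 0 := by
      simp [Matrix.det_fin_two_of]; exact_mod_cast hp.ne_zero
    have hD : glOfDet (!![(p : ℤ), 0; 0, 1]) hdetD • z = UpperHalfPlane.ofComplex ((p : ℂ) * (z : ℂ)) := by
      apply UpperHalfPlane.ext
      rw [UpperHalfPlane.ofComplex_apply_of_im_pos him, UpperHalfPlane.coe_smul_of_det_pos (by
        rw [glOfDet_det]; simp [Matrix.det_fin_two_of]; exact_mod_cast hp.pos)]
      simp [UpperHalfPlane.num, UpperHalfPlane.denom]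
    have hsplit : heckeGL σ hp j = Matrix.SpecialLinearGroup.mapGL ℝ σ * glOfDet (!![(p : ℤ), 0; 0, 1]) hdetD := by
      apply Units.ext
      simp only [Units.val_mul, heckeGL, glOfDet_coe, mapGL_coe_eq_map, ← map_intCast_mul, heckeMat, if_neg hj]
    rw [hsplit, mul_smul, hD]
    rfl

end HeckeGL

variable {p : ℕ} in
theorem slashHalf_heckeMat (hp : p.Prime) (σ : SL(2, ℤ)) (j : Fin (p + 1)) (φ : ℝ → ℂ) (t : ℝ) :
    Literature.NumberTheory.Automorphic.slashHalf (heckeMat p σ j) φ t = lineSlash (1 / 2) (heckeGL σ hp j) φ t :=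
  slashHalf_eq_lineSlash _ _ _ _

/-- `C²` is preserved by composition with the action of `g ∈ GL₂⁺(ℝ)`. [folklore] -/
theorem isC2_comp_smul {f : ℍ → ℂ} (hf : IsC2 f) {g : GL (Fin 2) ℝ} (hg : 0 < g.det.val) :
    IsC2 (fun w => f (g • w)) := by
  unfold IsC2
  rw [comp_smul_extend_eq]
  refine hf.comp (contDiffOn_smulExtend hg 2) fun z _ => ?_
  exact (g • ofComplex z).im_pos

variable {p : ℕ} in
/-- `T'_p u = Σ_j p^{-1/2} · (u ∘ M_j)` as functions on `ℍ`. [folklore] -/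
theorem heckeT_eq_sum (hp : p.Prime) (σ : SL(2, ℤ)) (u : ℍ → ℂ) :
    heckeT p σ u = fun z => ∑ j : Fin (p + 1), ((Real.sqrt p : ℝ) : ℂ)⁻¹ * u (heckeGL σ hp j • z) := by
  funext z
  simp only [← heckeAct_eq_smul σ hp]
  unfold heckeT heckeAct
  rw [← Finset.mul_sum, Fin.sum_univ_castSucc]
  congr 2
  · rw [Finset.sum_range]
    refine Finset.sum_congr rfl fun i _ => ?_
    simp only [Fin.val_castSucc, Fin.is_lt, if_true]
  · simp only [Fin.val_last, lt_self_iff_false, if_false]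

/-- **stub_linear** (linearity of the period integral in `u` over `C²` functions).
[cite: BruggemanLewisZagier2015, (1.9) p. 11] -/
theorem stub_linear : ∀ (s : ℂ) (n : ℕ) (c : Fin n → ℂ) (v : Fin n → UpperHalfPlane → ℂ),
    (∀ i, Literature.NumberTheory.Automorphic.IsC2 (v i)) → ∀ (a b : UpperHalfPlane) (t : ℝ),
    Literature.NumberTheory.Automorphic.greenPeriod s (fun z => ∑ i, c i * v i z) a b t =
      ∑ i, c i * Literature.NumberTheory.Automorphic.greenPeriod s (v i) a b t := by
  sorry

/-- **stub_pullback** (BLZ (2.25) + (1.10a) + (1.10c): the pull-back law of the period integral under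
`GL₂⁺(ℝ)`). [cite: BruggemanLewisZagier2015, (2.25) p. 16 and (1.10a) p. 11] -/
theorem stub_pullback : ∀ (s : ℂ) (u : UpperHalfPlane → ℂ) (g : GL (Fin 2) ℝ), 0 < g.det.val →
    Literature.NumberTheory.Automorphic.IsC2 u →
    (∀ z : UpperHalfPlane, Literature.NumberTheory.Automorphic.hypLaplacian u z + s * (1 - s) * u z = 0) →
    ∀ (a b : UpperHalfPlane) (t : ℝ), (g 1 0 : ℝ) * t + g 1 1 ≠ 0 →
    Literature.NumberTheory.Automorphic.greenPeriod s (fun z => u (g • z)) a b t =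
      ((g.det.val : ℝ) : ℂ) ^ s *
        Literature.NumberTheory.Automorphic.lineSlash s g
          (Literature.NumberTheory.Automorphic.greenPeriod s u (g • a) (g • b)) t := by
  sorry

/-- **Composition**: linearity + the `p + 1` pull-backs + `p^{-1/2} (det M_j)^{1/2} = 1`. [folklore] -/
theorem HeckePeriodIntertwining_of :
    (∀ (s : ℂ) (n : ℕ) (c : Fin n → ℂ) (v : Fin n → UpperHalfPlane → ℂ),
      (∀ i, Literature.NumberTheory.Automorphic.IsC2 (v i)) → ∀ (a b : UpperHalfPlane) (t : ℝ),
      Literature.NumberTheory.Automorphic.greenPeriod s (fun z => ∑ i, c i * v i z) a b t =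
        ∑ i, c i * Literature.NumberTheory.Automorphic.greenPeriod s (v i) a b t) →
    (∀ (s : ℂ) (u : UpperHalfPlane → ℂ) (g : GL (Fin 2) ℝ), 0 < g.det.val →
      Literature.NumberTheory.Automorphic.IsC2 u →
      (∀ z : UpperHalfPlane, Literature.NumberTheory.Automorphic.hypLaplacian u z + s * (1 - s) * u z = 0) →
      ∀ (a b : UpperHalfPlane) (t : ℝ), (g 1 0 : ℝ) * t + g 1 1 ≠ 0 →
      Literature.NumberTheory.Automorphic.greenPeriod s (fun z => u (g • z)) a b t =
        ((g.det.val : ℝ) : ℂ) ^ s *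
          Literature.NumberTheory.Automorphic.lineSlash s g
            (Literature.NumberTheory.Automorphic.greenPeriod s u (g • a) (g • b)) t) →
    HeckePeriodIntertwining := by
  intro hL hP
  refine heckePeriodIntertwining_iff.mpr ?_
  intro N hN p hp hpN σ hσ hσp u hu γ
  have hp0 : (0 : ℝ) < p := by exact_mod_cast hp.pos
  -- the eigen-equation in the `s(1-s)` form
  have heig : ∀ z : ℍ, hypLaplacian u z + (1 / 2 : ℂ) * (1 - 1 / 2) * u z = 0 := fun z => by
    have h := hu.2.2.1 z
    rw [← h]; norm_num
  -- `p^{-1/2} · (det M_j)^{1/2} = 1`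
  have hcancel : ∀ j : Fin (p + 1),
      ((Real.sqrt p : ℝ) : ℂ)⁻¹ * (((heckeGL σ hp j).det.val : ℝ) : ℂ) ^ (1 / 2 : ℂ) = 1 := by
    intro j
    have hdet : ((heckeGL σ hp j).det.val : ℝ) = (p : ℝ) := by
      unfold heckeGL; rw [glOfDet_det, heckeMat_det σ hp j]; push_cast; rfl
    rw [hdet, show (1 / 2 : ℂ) = ((1 / 2 : ℝ) : ℂ) by norm_num, ← Complex.ofReal_cpow hp0.le,
      ← Real.sqrt_eq_rpow]
    have hs : ((Real.sqrt p : ℝ) : ℂ) ≠ 0 := by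
      exact_mod_cast (Real.sqrt_pos.mpr hp0).ne'
    exact inv_mul_cancel₀ hs
  -- all poles avoided at once
  have hpoles : ∀ᶠ t in cofinite, ∀ j : Fin (p + 1),
      (heckeGL σ hp j) 1 0 * t + (heckeGL σ hp j) 1 1 ≠ 0 :=
    Filter.eventually_all.mpr fun j => eventually_cofinite_ne_linePole (heckeGL σ hp j)
  filter_upwards [hpoles] with t ht
  -- linearity
  rw [lewisZagierCocycle, heckeT_eq_sum hp σ u,
    hL (1 / 2) (p + 1) (fun _ => ((Real.sqrt p : ℝ) : ℂ)⁻¹) (fun j z => u (heckeGL σ hp j • z))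
      (fun j => isC2_comp_smul hu.1 (heckeGL_det_pos σ hp j))]
  refine Finset.sum_congr rfl fun j _ => ?_
  -- pull-back along `M_j`
  rw [hP (1 / 2) u (heckeGL σ hp j) (heckeGL_det_pos σ hp j) hu.1 heig _ _ t (ht j), ← mul_assoc,
    hcancel j, one_mul, slashHalf_heckeMat hp σ j, heckeAct_eq_smul σ hp j, heckeAct_eq_smul σ hp j,
    sl_smul_eq_mapGL_smul, map_inv]

end Summit.Langlands.Langlands.Cruxes.HeckePreservesRationalPeriods.BirthHeckePeriodIntertwining
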